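import Summits.CriticalPhenomena.SAWScalingLimit.Theorems.SAWLoopFugacityFlowIsingBoundaryRatioWindowRectWhisker
import HarnessLib

/-!
# Tails against test points, inside points and other tails
(line `fk-anchor-transfer`, crux `IsingBoundaryRatio`, stmt-CriticalPhenomena-10650; helper file of the stub
`windowRectPresentation_holds`)

Pointwise separation facts for the non-interleaving theorem (`…WindowRectNonInterleave`), all in the frame
calculus of `…WindowRectPolygonCoords`: a tail (`framePt δ (x', k') s 0`, `η ≤ s ≤ s⋆ ≤ δ`, stopping `2η`
before a vertex far end) contains no point within `η` of a vertex in both coordinates (`inside_ne_tail`),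
no test point `framePt δ (x, k) (η + u) c` (`|u| ≤ η/4`, `|c| ≤ η/2`) of a different arrow at a vertex
(`test_ne_tail`), and two tails of different arrows with different feet are disjoint (`tail_ne_tail`);
finally the distance from a frame point to its lattice point (`norm_framePt_sub`). [folklore]
-/

noncomputable section

open scoped Classical
open Set Metric Complex Literature.Probability.LatticeModels Literature.Probability.LatticeModels.DiscreteRect

namespace Summit.CriticalPhenomena.SAWScalingLimit.Theorems.IsingBoundaryRatio

namespace WindowRect

variable {δ η : ℝ} {E : Finset (Sym2 (Site 2))}

/-- **Distance from a frame point to its lattice point**: `‖framePt δ (x,k) a b - δx‖² = a² + b²`.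
[folklore] -/
theorem normSq_framePt_sub (x : Site 2) (k : Fin 4) (a b : ℝ) :
    Complex.normSq (framePt δ (x, k) a b - meshPoint δ x) = a ^ 2 + b ^ 2 := by
  obtain ⟨cre, cim⟩ := framePt_sub_coords (δ := δ) x k a b
  rw [Complex.normSq_apply]
  have hre : (framePt δ (x, k) a b - meshPoint δ x).re = a * dir k 0 - b * dir k 1 := by
    rw [Complex.sub_re, meshPoint_re]; exact cre
  have him : (framePt δ (x, k) a b - meshPoint δ x).im = a * dir k 1 + b * dir k 0 := by
    rw [Complex.sub_im, meshPoint_im]; exact cim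
  rw [hre, him]
  rcases dir_apply_cases k with ⟨h0, h1⟩ | ⟨h0, h1⟩ | ⟨h0, h1⟩ | ⟨h0, h1⟩ <;> rw [h0, h1] <;> push_cast <;> ring

/-- A frame point with `|a|, |b| ≤ c` is within `2c` of its lattice point. [folklore] -/
theorem dist_framePt_lt (x : Site 2) (k : Fin 4) {a b c : ℝ} (ha : |a| ≤ c) (hb : |b| ≤ c) (hc : 0 < c) :
    dist (framePt δ (x, k) a b) (meshPoint δ x) < 2 * c := by
  rw [dist_eq_norm, ← abs_norm, ← abs_of_pos (by linarith : 0 < 2 * c), ← sq_lt_sq, ← Complex.normSq_eq_norm_sq,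
    normSq_framePt_sub]
  have ha2 : a ^ 2 ≤ c ^ 2 := by rw [← sq_abs a]; exact pow_le_pow_left₀ (abs_nonneg a) ha 2
  have hb2 : b ^ 2 ≤ c ^ 2 := by rw [← sq_abs b]; exact pow_le_pow_left₀ (abs_nonneg b) hb 2
  nlinarith

/-! ### Tails against nearby points -/

/-- **A tail misses the points within `η` (in both frame coordinates) of a vertex.** [folklore] -/
theorem inside_ne_tail (hδ : 0 < δ) (hη : 0 < η) (h4 : 4 * η ≤ δ) {x : Site 2} {k : Fin 4} (hx : x ∈ verts E)
    {a b : ℝ} (ha : |a| < η) (hb : |b| < η) {x' : Site 2} {k' : Fin 4} {s : ℝ} (hs : η ≤ s) (hsδ : s ≤ δ)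
    (hstop : x' + dir k' ∈ verts E → s ≤ δ - 2 * η) : framePt δ (x, k) a b ≠ framePt δ (x', k') s 0 := by
  intro h
  by_cases hxx : x = x'
  · subst hxx
    rcases framePt_eq_frame (δ := δ) x k' k s 0 with ⟨-, h'⟩ | ⟨-, h'⟩ | ⟨-, h'⟩ | ⟨-, h'⟩ <;>
      rw [h', framePt_inj_iff] at h <;> obtain ⟨h1, h2⟩ := h
    · rw [h1, abs_of_nonneg (by linarith)] at ha; linarith
    · rw [h2, abs_of_nonneg (by linarith)] at hb; linarith
    · rw [h1, abs_neg, abs_of_nonneg (by linarith)] at ha; linarith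
    · rw [h2, abs_neg, abs_of_nonneg (by linarith)] at hb; linarith
  · obtain ⟨hre, him⟩ := framePt_offsets_lt (δ := δ) (x := x) (k := k) ha hb
    rw [h] at hre him
    rcases tail_far hδ h4 (by linarith) hsδ hstop hx hxx with h' | h' <;> linarith

/-- **A tail misses the test points of a different arrow at a vertex**: points `framePt δ (x, k) (η + u) c`
with `|u| ≤ η/4`, `|c| ≤ η/2`. [folklore] -/
theorem test_ne_tail (hδ : 0 < δ) (hη : 0 < η) (h4 : 4 * η ≤ δ) {x : Site 2} {k : Fin 4} (hx : x ∈ verts E)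
    {u c : ℝ} (hu : |u| ≤ η / 4) (hc : |c| ≤ η / 2) {x' : Site 2} {k' : Fin 4} (hne : (x', k') ≠ (x, k)) {s : ℝ}
    (hs : η ≤ s) (hsδ : s ≤ δ) (hstop : x' + dir k' ∈ verts E → s ≤ δ - 2 * η) :
    framePt δ (x, k) (η + u) c ≠ framePt δ (x', k') s 0 := by
  intro h
  by_cases hxx : x' = x
  · subst hxx
    have hk : k' ≠ k := fun hk => hne (by rw [hk])
    exact ray_ne_of_pos (by linarith) (by rw [abs_le] at hu; linarith [hu.1]) hk h.symm
  · have hb1 : |η + u| < 2 * η := by rw [abs_lt]; rw [abs_le] at hu; constructor <;> linarith [hu.1, hu.2]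
    have hb2 : |c| < 2 * η := by rw [abs_le] at hc; rw [abs_lt]; constructor <;> linarith [hc.1, hc.2]
    obtain ⟨hre, him⟩ := framePt_offsets_lt (δ := δ) (x := x) (k := k) hb1 hb2
    rw [h] at hre him
    have hxx' : x ≠ x' := fun h' => hxx h'.symm
    rcases tail_far hδ h4 (by linarith) hsδ hstop hx hxx' with h' | h' <;> linarith

/-! ### Two tails -/

/-- **Two tails of different arrows with different feet are disjoint.** The tails are
`framePt δ (x, k) s 0`, `0 < s ≤ S`, and `framePt δ (x', k') s' 0`, `0 < s' ≤ S'`, where `S, S' ≤ δ` are the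
foot parameters (the rays before the feet lie in the open set `U` containing the vertices, the feet do not);
for opposite arrows of one edge the foot parameters satisfy `S + S' < δ`. [folklore] -/
theorem tail_ne_tail (hδ : 0 < δ) {U : Set ℂ} {x x' : Site 2} {k k' : Fin 4} (hne : (x, k) ≠ (x', k'))
    (hxU : meshPoint δ x ∈ U) (hx'U : meshPoint δ x' ∈ U) {S S' s s' : ℝ} (hS : S ≤ δ) (hS' : S' ≤ δ)
    (hs : 0 < s ∧ s ≤ S) (hs' : 0 < s' ∧ s' ≤ S')
    (hbefore : ∀ t ∈ Ico 0 S, framePt δ (x, k) t 0 ∈ U) (hbefore' : ∀ t ∈ Ico 0 S', framePt δ (x', k') t 0 ∈ U)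
    (hfoot : framePt δ (x, k) S 0 ∉ U) (hfoot' : framePt δ (x', k') S' 0 ∉ U)
    (hfeet : framePt δ (x, k) S 0 ≠ framePt δ (x', k') S' 0)
    (hopp : x' = x + dir k → k' = k + 2 → S + S' < δ)
    (h : framePt δ (x, k) s 0 = framePt δ (x', k') s' 0) : False := by
  -- both points lie on the closed lattice edges
  have hseg : ∀ {y : Site 2} {K : Fin 4} {t : ℝ}, 0 ≤ t → t ≤ δ →
      framePt δ (y, K) t 0 ∈ segment ℝ (meshPoint δ y) (meshPoint δ (y + dir K)) := by
    intro y K t ht0 htδ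
    rw [← framePt_origin y K, ← framePt_far y K, segment_eq_image_lineMap]
    refine ⟨t / δ, ⟨by positivity, (div_le_one hδ).2 htδ⟩, ?_⟩
    rw [framePt_lineMap_fst]; congr 1; field_simp; ring
  have hz := hseg (y := x) (K := k) hs.1.le (hs.2.trans hS)
  have hz' := hseg (y := x') (K := k') hs'.1.le (hs'.2.trans hS')
  rw [h] at hz
  obtain ⟨m, hm, hm'⟩ := exists_common_endpoint hδ (zdGraph_adj_add_dir x k) (zdGraph_adj_add_dir x' k') hz hz'
  -- a tail point strictly before the foot is in `U`, the foot is not: so a tail point equal to a foot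
  -- of the other arrow forces equal feet
  have tail_pt : ∀ {y : Site 2} {K : Fin 4} {T t : ℝ}, (∀ t' ∈ Ico 0 T, framePt δ (y, K) t' 0 ∈ U) →
      0 < t ∧ t ≤ T → framePt δ (y, K) t 0 ∉ U → t = T := by
    intro y K T t hb ht hnot
    by_contra hne'
    exact hnot (hb t ⟨ht.1.le, lt_of_le_of_ne ht.2 hne'⟩)
  have fin4 : ∀ a b : Fin 4, a + 2 = b → a = b + 2 := by decide
  rcases hm with hm | hm <;> rcases hm' with hm' | hm'
  · -- common base point
    rw [← hm', hm] at h
    obtain ⟨hkk, -⟩ := ray_eq hs.1 hs'.1.le h.symm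
    exact hne (by rw [← hm', hm, hkk])
  · -- `x = x' + e_{k'}`: the second tail seen from `x`
    have h2 : framePt δ (x', k') s' 0 = framePt δ (x, k' + 2) (δ - s') 0 := by
      rw [framePt_reverse x' k' s' 0, neg_zero, ← hm', hm]
    rw [h2] at h
    rcases (sub_nonneg.2 (hs'.2.trans hS')).eq_or_lt with h0 | hpos
    · have hs'δ : s' = δ := by linarith
      have hS'δ : S' = δ := le_antisymm hS' (hs'δ ▸ hs'.2)
      apply hfoot'
      rw [hS'δ, framePt_far, ← hm', hm]
      exact hxU
    · obtain ⟨hkk, hss⟩ := ray_eq hs.1 hpos.le h.symm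
      have hx' : x' = x + dir k := by
        rw [← hkk, dir_add_two, ← sub_eq_add_neg, eq_sub_iff_add_eq, ← hm', hm]
      have := hopp hx' (fin4 _ _ hkk)
      linarith [hs.2, hs'.2]
  · -- `x' = x + e_k`: symmetric
    have h1 : framePt δ (x, k) s 0 = framePt δ (x', k + 2) (δ - s) 0 := by
      rw [framePt_reverse x k s 0, neg_zero, ← hm, hm']
    rw [h1] at h
    rcases (sub_nonneg.2 (hs.2.trans hS)).eq_or_lt with h0 | hpos
    · have hsδ : s = δ := by linarith
      have hSδ : S = δ := le_antisymm hS (hsδ ▸ hs.2)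
      apply hfoot
      rw [hSδ, framePt_far, ← hm, hm']
      exact hx'U
    · obtain ⟨hkk, hss⟩ := ray_eq hs'.1 hpos.le h
      have hx' : x' = x + dir k := by rw [← hm, hm']
      have := hopp hx' hkk.symm
      linarith [hs.2, hs'.2]
  · -- common far point
    have h1 : framePt δ (x, k) s 0 = framePt δ (m, k + 2) (δ - s) 0 := by
      rw [framePt_reverse x k s 0, neg_zero, ← hm]
    have h2 : framePt δ (x', k') s' 0 = framePt δ (m, k' + 2) (δ - s') 0 := by
      rw [framePt_reverse x' k' s' 0, neg_zero, ← hm']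
    rcases (sub_nonneg.2 (hs.2.trans hS)).eq_or_lt with h0 | hpos
    · -- `s = δ = S`: the first foot is a point of the second tail
      have hsδ : s = δ := by linarith
      have hSδ : S = δ := le_antisymm hS (hsδ ▸ hs.2)
      have hpt : framePt δ (x', k') s' 0 = framePt δ (x, k) S 0 := by rw [← h, hSδ, hsδ]
      have hs'S : s' = S' := tail_pt hbefore' hs' (hpt ▸ hfoot)
      exact hfeet (by rw [← hpt, hs'S])
    rcases (sub_nonneg.2 (hs'.2.trans hS')).eq_or_lt with h0' | hpos'
    · have hs'δ : s' = δ := by linarith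
      have hS'δ : S' = δ := le_antisymm hS' (hs'δ ▸ hs'.2)
      have hpt : framePt δ (x, k) s 0 = framePt δ (x', k') S' 0 := by rw [h, hS'δ, hs'δ]
      have hsS : s = S := tail_pt hbefore hs (hpt ▸ hfoot')
      exact hfeet (by rw [← hsS, hpt])
    · rw [h1, h2] at h
      obtain ⟨hkk, -⟩ := ray_eq hpos hpos'.le h.symm
      have hk : k' = k := add_right_cancel hkk
      have hx : x' = x := by
        have := hm.symm.trans hm'
        rw [hk] at this
        exact (add_right_cancel this).symm
      exact hne (by rw [hx, hk])

end WindowRect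

/-- **Distance from a frame point to its lattice point**, closed form (registered sub-goal of
stmt-CriticalPhenomena-10650). [folklore] -/
theorem windowRect_normSq_framePt_sub : ∀ {δ : ℝ} (x : Site 2) (k : Fin 4) (a b : ℝ), Complex.normSq (WindowRect.framePt δ (x, k) a b - meshPoint δ x) = a ^ 2 + b ^ 2 :=
  fun x k a b => WindowRect.normSq_framePt_sub x k a b

end Summit.CriticalPhenomena.SAWScalingLimit.Theorems.IsingBoundaryRatio

end
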